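import Summits.HodgeConjecture.HodgeConjecture.Theorems.NikulinTwinTransportSquareGlue
import Literature.AlgebraicGeometry.HodgeTheory.HodgeIndexSurface
import Literature.AlgebraicGeometry.HodgeTheory.LefschetzOneOne

/-!
# Route AnchorTransport — `AnchorExistence` (stmt-HodgeConjecture-1077), line `Sketch`, CM floor:
# rational `(2,2)`-classes on `S × S` are algebraic once every Hodge endomorphism of `H²(S)` is

The `(2,2)`-part of the Künneth bookkeeping "proving the Hodge conjecture for `X²` is equivalent
to showing that every element of `End_Hdg(T(X))` is algebraic" (Varesco 2023, p. 8; Voisin I,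
Lemma 11.41) for a projective K3 surface `S`, with the endomorphism step ABSTRACTED: granted that
every rational type-preserving endomorphism of `H²(S(ℂ); ℂ)` is induced by an algebraic class on
`S ⊗ S` (`[Γ]_* = fst_*(snd^*(–) ∪ Γ)`), every rational `(2,2)`-class on `S ⊗ S` is algebraic
(`anchorExistence_cmFloor_mem_algebraicClasses_two_of_endomorphisms`; symbol for symbol the proof
of route NikulinTwinTransport's `mem_algebraicClasses_two_of_sector`). Also recorded: the
splitting input `NS ∩ T = 0` from the Hodge index theorem
(`anchorExistence_cmFloor_divisorClass_eq_zero_of_hodgeIndex`). Both serve the CM floor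
`anchorExistence_k3Square_floor_of_CM` of the lead skeleton of line `Sketch`.

## References

* [Varesco2023] M. Varesco, Hodge similitudes and the Hodge conjecture for squares of K3 surfaces
  (2023), §2 (p. 8).
* [VoisinHodgeI2002] C. Voisin, Hodge Theory and Complex Algebraic Geometry I, CUP 2002, §11.3.3
  Lemma 11.41.
* [Hartshorne1977] R. Hartshorne, Algebraic Geometry, Springer 1977, V Rem. 1.9.1, App. A Thm. 5.2.
* [HatcherAT2002] A. Hatcher, Algebraic Topology, CUP 2002, §3.2 Thm. 3.15.
-/

noncomputable section

set_option linter.dupNamespace false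

open scoped Manifold
open Module CategoryTheory MonoidalCategory CartesianMonoidalCategory
open Literature.AlgebraicGeometry.Motives Literature.AlgebraicGeometry.HodgeTheory
open Literature.AlgebraicGeometry.Surfaces Literature.Geometry.Kaehler
open Literature.AlgebraicTopology.SingularHomology

namespace Summit.HodgeConjecture.HodgeConjecture.Theorems

open Summit.HodgeConjecture.HodgeConjecture.Theorems.NikulinTwinTransport

variable {S : SchemeOver ℂ}

/-! ### Non-degeneracy of the cup form on rational divisor classes (Hodge index) -/

/-- **A rational divisor class of a projective K3 surface orthogonal to all divisor classes is
zero**, from the Hodge index theorem for `S` (`hodgeIndex_surface S`, sign-free form), Lefschetz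
`(1,1)` and `N¹H² ⊆ H^{1,1}` (`Grothendieck1969_supportedClasses_le_hodgeConiveau`): a non-zero
rational `(1,1)`-class pairs non-trivially with some rational divisor class
(`exists_cup_ne_zero_of_hodgeIndex`). This is the splitting `H² = NS ⊕ T` of the Künneth
bookkeeping. [cite: Hartshorne1977, V Rem. 1.9.1 and App. A Thm. 5.2] -/
theorem anchorExistence_cmFloor_divisorClass_eq_zero_of_hodgeIndex (hHI : hodgeIndex_surface S)
    (hL : lefschetzOneOne_rational) (hG : Grothendieck1969_supportedClasses_le_hodgeConiveau)
    (hS : IsK3Surface S) {c : complexBetti S (2 * 1)} (hcN : c ∈ algebraicClasses S 1)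
    (hc : IsRationalClass c)
    (hperp : ∀ d ∈ algebraicClasses S 1, cupProduct (rfl : 2 * 1 + 2 * 1 = 2 * 2) c d = 0) :
    c = 0 := by
  by_contra hc0
  have h11 : IsOfHodgeType 2 S (2 * 1) 1 1 c :=
    NikulinTwinTransport.isOfHodgeType_oneOne_of_mem_algebraicClasses hG hS hcN
  obtain ⟨d, -, -, hdN, hcd⟩ := exists_cup_ne_zero_of_hodgeIndex hHI hL hS.1 c hc h11 hc0
  exact hcd (hperp d hdN)

/-- `Corr[μ, hS ; γ, y] = fst_*(snd^* y ∪ γ) = [γ]_* y` on `H²(S(ℂ); ℂ)`, symbol for symbol the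
shape of route NikulinTwinTransport's statements. Local notation only. -/
local notation3 (prettyPrint := false) "Corr[" μ ", " hS " ; " γ ", " y "]" =>
  complexGysin μ (IsSmoothProjective.tensor_holds (And.left hS) (And.left hS)) (And.left hS)
    (SemiCartesianMonoidalCategory.fst _ _) (rfl : 2 * 1 + 2 * 2 + 2 * 2 = 2 * 1 + 2 * (2 + 2))
    (cupProduct (rfl : 2 * 1 + 2 * 2 = 2 * 1 + 2 * 2)
      (complexBetti.map (SemiCartesianMonoidalCategory.snd _ _) (2 * 1) y) γ)

/-! ### Rational `(2,2)`-classes on `S × S` are algebraic once all Hodge endomorphisms of `H²(S)` are -/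

/-- **Rational `(2,2)`-classes on `S × S` are algebraic once every rational Hodge endomorphism of
`H²(S)` is induced by an algebraic class** (`hEnd`), for a projective K3 surface `S`, GRANTED the
Künneth spanning property of `(S ⊗ S)(ℂ)` in degrees `4` and `8`, `H¹(S(ℂ)) = H³(S(ℂ)) = 0` and
the named facts `hodgePQ_independent_of_hodgeModel`, `exists_deRhamIsoFamily`: the action `[c]_*`
on `H²(S)` is, up to the orientation scalar `u`, rational and type-preserving
(`exists_smul_complexGysin_isRationalClass`, `isOfHodgeType_corrFst`), hence `[Γ]_*` for an
algebraic `Γ`; the actions of `c - u⁻¹Γ` on `H⁰` and `H⁴` are scalars `t₀`, `t₄`, and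
`c - u⁻¹Γ - t₀κ⁻¹ pr₂^* p₀ - t₄κ⁻¹ pr₁^* p₀` acts trivially on `H⁰ ⊕ H² ⊕ H⁴`, hence vanishes
(`eq_zero_of_corr_eq_zero_four`). Symbol for symbol the proof of `mem_algebraicClasses_two_of_sector`
with its endomorphism step abstracted; the `(2,2)`-part of the Künneth bookkeeping "HC for `S²` ⟺
`End_Hdg(T(S))` algebraic". [cite: Varesco2023, §2 (p. 8)] [cite: HatcherAT2002, §3.2 Thm. 3.15] -/
theorem anchorExistence_cmFloor_mem_algebraicClasses_two_of_endomorphisms (hI : hodgePQ_independent_of_hodgeModel)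
    (hdR : ∀ (E : Type) [NormedAddCommGroup E] [NormedSpace ℂ E] [FiniteDimensional ℂ E],
      Literature.NumberTheory.Transcendental.exists_deRhamIsoFamily 𝓘(ℝ, E))
    (μ : OrientationFamily) (hS : IsK3Surface S)
    (hK4 : ∀ z : complexBetti (S ⊗ S) (2 * 2), z ∈ Submodule.span ℂ
      {v | ∃ (i j : ℕ) (h : i + j = 2 * 2) (b : complexBetti S i) (w : complexBetti S j),
        v = cupProduct h (complexBetti.map (fst S S) i b) (complexBetti.map (snd S S) j w)})
    (hKtop : ∀ z : complexBetti (S ⊗ S) (2 * (2 + 2)), z ∈ Submodule.span ℂ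
      {v | ∃ (i j : ℕ) (h : i + j = 2 * (2 + 2)) (b : complexBetti S i) (w : complexBetti S j),
        v = cupProduct h (complexBetti.map (fst S S) i b) (complexBetti.map (snd S S) j w)})
    (h1 : Subsingleton (complexBetti S 1)) (h3 : Subsingleton (complexBetti S 3))
    (hEnd : ∀ (F : complexBetti S (2 * 1) →ₗ[ℂ] complexBetti S (2 * 1)),
      (∀ y, IsRationalClass y → IsRationalClass (F y)) →
      (∀ (i j : ℕ) y, IsOfHodgeType 2 S (2 * 1) i j y → IsOfHodgeType 2 S (2 * 1) i j (F y)) →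
      ∃ Γ ∈ algebraicClasses (S ⊗ S) 2, ∀ y : complexBetti S (2 * 1), F y = Corr[μ, hS ; Γ, y])
    (c : complexBetti (S ⊗ S) (2 * 2)) (hc : IsRationalClass c)
    (hct : IsOfHodgeType (2 + 2) (S ⊗ S) (2 * 2) 2 2 c) :
    c ∈ algebraicClasses (S ⊗ S) 2 := by
  classical
  -- Hodge models: of `S ⊗ S` from the Hodge-type hypothesis, of `S` from the K3 hypothesis
  obtain ⟨B, -⟩ := id hct
  obtain ⟨A⟩ := hS.nonempty_hodgeModel
  -- the action of `c` on `H²(S)` as a linear map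
  let Fc : complexBetti S (2 * 1) →ₗ[ℂ] complexBetti S (2 * 1) :=
    (complexGysin μ (IsSmoothProjective.tensor_holds hS.1 hS.1) hS.1 (fst S S)
        (rfl : 2 * 1 + 2 * 2 + 2 * 2 = 2 * 1 + 2 * (2 + 2))) ∘ₗ
      ((cupProduct (rfl : 2 * 1 + 2 * 2 = 2 * 1 + 2 * 2)).flip c) ∘ₗ (complexBetti.map (snd S S) (2 * 1)).hom
  have hFc : ∀ y, Fc y = Corr[μ, hS ; c, y] := fun y => rfl
  -- rational up to one scalar, and type-preserving
  obtain ⟨u, hu0, hu⟩ := exists_smul_complexGysin_isRationalClass μ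
    (IsSmoothProjective.tensor_holds hS.1 hS.1) hS.1 (fst S S) (rfl : 2 * 1 + 2 * 2 + 2 * 2 = 2 * 1 + 2 * (2 + 2))
  have hF_rat : ∀ y, IsRationalClass y → IsRationalClass ((u • Fc) y) := fun y hy => by
    rw [LinearMap.smul_apply, hFc]
    exact hu _ (IsRationalClass.cup _ (IsRationalClass.map _ hy) hc)
  have hF_typ : ∀ (i j : ℕ) y, IsOfHodgeType 2 S (2 * 1) i j y →
      IsOfHodgeType 2 S (2 * 1) i j ((u • Fc) y) := fun i j y hy => by
    rw [LinearMap.smul_apply, hFc]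
    exact isOfHodgeType_smul' (isOfHodgeType_corrFst hI hdR μ hS.1 hS.1 B A
      (rfl : 2 * 1 + 2 * 2 = 2 * 1 + 2 * 2) (rfl : 2 * 1 + 2 * 2 + 2 * 2 = 2 * 1 + 2 * (2 + 2)) hct
      (rfl : i + 2 = i + 2) (rfl : j + 2 = j + 2) hy) u
  -- `u [c]_* = [Γ]_*` with `Γ` algebraic
  obtain ⟨Γ, hΓalg, hΓ⟩ := hEnd (u • Fc) hF_rat hF_typ
  -- a generator `p₀` of `H⁴(S)`, the fibre integral `κ`
  obtain ⟨p₀, hp₀'⟩ := exists_kroneckerPairing_fundamentalClass_ne_zero μ hS.1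
  have hp₀ : p₀ ≠ 0 := by
    rintro rfl
    exact hp₀' (by rw [map_zero, LinearMap.zero_apply])
  obtain ⟨κ, hκ0, hκ⟩ := exists_fibreIntegral_fst μ hS.1 hS.1 hKtop hp₀ (rfl : 2 * 2 + 2 * 2 = 0 + 2 * (2 + 2))
  have hκinv : κ⁻¹ * κ = 1 := inv_mul_cancel₀ hκ0
  -- `c₁ = c - u⁻¹ Γ` acts trivially on `H²`
  set c₁ : complexBetti (S ⊗ S) (2 * 2) := c - u⁻¹ • Γ with hc₁
  have hA2 : ∀ y : complexBetti S (2 * 1), Corr[μ, hS ; c₁, y] = 0 := fun y => by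
    have h := hΓ y
    rw [LinearMap.smul_apply, hFc] at h
    rw [hc₁, map_sub, map_smul, map_sub, map_smul, ← h, smul_smul, inv_mul_cancel₀ hu0, one_smul, sub_self]
  -- its actions on `H⁰`, `H⁴` are scalars `t₀`, `t₄`
  obtain ⟨t₀, ht₀⟩ := exists_eq_smul_one μ hS.1
    (complexGysin μ (IsSmoothProjective.tensor_holds hS.1 hS.1) hS.1 (fst S S)
      (rfl : 2 * 2 + 2 * 2 = 0 + 2 * (2 + 2))
      (cupProduct (Nat.zero_add (2 * 2)) (complexBetti.map (snd S S) 0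
        (singularCohomology.one ℂ (ComplexPoints S))) c₁))
  obtain ⟨t₄, ht₄⟩ := exists_eq_smul_of_top μ hS.1 hp₀
    (complexGysin μ (IsSmoothProjective.tensor_holds hS.1 hS.1) hS.1 (fst S S)
      (rfl : 2 * 2 + 2 * 2 + 2 * 2 = 2 * 2 + 2 * (2 + 2))
      (cupProduct (rfl : 2 * 2 + 2 * 2 = 2 * 2 + 2 * 2) (complexBetti.map (snd S S) (2 * 2) p₀) c₁))
  -- `c₂ = c₁ - t₀κ⁻¹ pr₂^* p₀ - t₄κ⁻¹ pr₁^* p₀` acts trivially in every degree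
  set c₂ : complexBetti (S ⊗ S) (2 * 2) := c₁ - (t₀ * κ⁻¹) • complexBetti.map (snd S S) (2 * 2) p₀ -
    (t₄ * κ⁻¹) • complexBetti.map (fst S S) (2 * 2) p₀ with hc₂
  have hone : cupProduct (Nat.zero_add (2 * 2)) (singularCohomology.one ℂ (ComplexPoints S)) p₀ = (1 : ℂ) • p₀ := by
    rw [one_cupProduct, one_smul]
  have hc₂0 : c₂ = 0 := by
    refine eq_zero_of_corr_eq_zero_four μ hS.1 hS.1 hK4 h1 h3 (fun w => ?_) (fun y => ?_) (fun w => ?_)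
    · -- on `H⁰`
      obtain ⟨t, rfl⟩ := exists_eq_smul_one μ hS.1 w
      rw [map_smul, LinearMap.map_smul₂, map_smul, hc₂, map_sub, map_sub, map_smul, map_smul, map_sub,
        map_sub, map_smul, map_smul, ht₀,
        corrFst_mapSnd_of_cup_eq μ hS.1 hS.1 (Nat.zero_add (2 * 2)) _ hκ hone,
        corrFst_mapFst_eq_zero_of_lt μ hS.1 hS.1 (Nat.zero_add (2 * 2)) _ (by norm_num), smul_zero, sub_zero,
        smul_smul, one_mul, mul_assoc, hκinv, mul_one, sub_self, smul_zero]
    · -- on `H²`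
      rw [hc₂, map_sub, map_sub, map_smul, map_smul, map_sub, map_sub, map_smul, map_smul, hA2 y,
        corrFst_mapSnd_eq_zero_of_lt μ hS.1 hS.1 (rfl : 2 * 1 + 2 * 2 = 2 * 1 + 2 * 2) _ (by norm_num),
        corrFst_mapFst_eq_zero_of_lt μ hS.1 hS.1 (rfl : 2 * 1 + 2 * 2 = 2 * 1 + 2 * 2) _ (by norm_num),
        smul_zero, smul_zero, sub_zero, sub_zero]
    · -- on `H⁴`
      obtain ⟨t, rfl⟩ := exists_eq_smul_of_top μ hS.1 hp₀ w
      rw [map_smul, LinearMap.map_smul₂, map_smul, hc₂, map_sub, map_sub, map_smul, map_smul, map_sub,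
        map_sub, map_smul, map_smul, ht₄,
        corrFst_mapSnd_eq_zero_of_lt μ hS.1 hS.1 (rfl : 2 * 2 + 2 * 2 = 2 * 2 + 2 * 2) _ (by norm_num),
        corrFst_mapFst_of_fibreIntegral μ hS.1 hS.1 (rfl : 2 * 2 + 2 * 2 = 2 * 2 + 2 * 2) _ _ hκ,
        smul_zero, sub_zero, smul_smul, mul_assoc, hκinv, mul_one, sub_self, smul_zero]
  -- hence `c = u⁻¹ Γ + t₀κ⁻¹ pr₂^* p₀ + t₄κ⁻¹ pr₁^* p₀` is algebraic
  have hp₀alg : p₀ ∈ algebraicClasses S 2 := mem_algebraicClasses_of_degree_top hS.1 (by norm_num) p₀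
  have hceq : c = u⁻¹ • Γ + (t₀ * κ⁻¹) • complexBetti.map (snd S S) (2 * 2) p₀ +
      (t₄ * κ⁻¹) • complexBetti.map (fst S S) (2 * 2) p₀ := by
    rw [hc₂, hc₁, sub_sub, sub_sub, sub_eq_zero] at hc₂0
    rw [hc₂0, add_assoc]
  rw [hceq]
  exact Submodule.add_mem _ (Submodule.add_mem _ (Submodule.smul_mem _ _ hΓalg)
    (Submodule.smul_mem _ _ (map_snd_mem_algebraicClasses hS.1 hS.1 hp₀alg)))
    (Submodule.smul_mem _ _ (map_fst_mem_algebraicClasses hS.1 hS.1 hp₀alg))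

end Summit.HodgeConjecture.HodgeConjecture.Theorems

end
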